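import Summits.AtomisticToContinuum.HydrodynamicLimit.Theorems.JParityClosureLocalSecondLawLedgerDefs
import Summits.AtomisticToContinuum.HydrodynamicLimit.Theorems.JParityClosureLocalSecondLawCollisionalWorkRegularity
import Mathlib.Analysis.Calculus.ContDiff.RCLike
import Mathlib.Analysis.SpecialFunctions.Log.Deriv

/-!
# Entropy ledger for `JParityClosure.LocalSecondLaw` — one-variable calculus of the coarse thermodynamics
(stmt-AtomisticToContinuum-13081, line `exact-entropy-ledger-three-passivities`, layer 2 of stub L)

Elementary real-analysis facts used by the pathwise entropy ledger: a small Lipschitz toolkit for bounded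
real functions (products, inverses bounded away from zero, post-composition, finite sums), the
equation-of-state band (`EosBand`: the excess free energy is smooth on `(0, η₀)`), the smooth branch `Hsm` of
the guarded entropy `Hs` with its chain rule along differentiable curves `(ρ(t), θ(t))`, the
supporting-hyperplane (convexity) inequality of `(m, e) ↦ H(ρ, θ(ρ, m, e))` at fixed `ρ` (concavity of `log`
and of `θ` in `(m, e)`), and the derivatives of the coarse temperature, velocity and kinetic heat current along
a differentiable curve of linear velocity moments.

References: H. B. Callen, *Thermodynamics* (2nd ed. 1985) §1.9–2.3 (Gibbs relation); S. R. de Groot, P. Mazur,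
*Non-Equilibrium Thermodynamics* (1962) Ch. II §2 (entropy balance).
-/

noncomputable section

namespace Summit.AtomisticToContinuum.HydrodynamicLimit.Theorems.LocalSecondLawLedger

open scoped BigOperators Topology
open Filter Set
open Literature.MathematicalPhysics.KineticTheory
open Summit.AtomisticToContinuum.HydrodynamicLimit.Theorems.LocalSecondLawNegative

namespace L

/-! ## A Lipschitz toolkit for bounded real functions -/

section Lipschitz

variable {α : Type*} [PseudoMetricSpace α]

/-- A product of bounded Lipschitz real functions is Lipschitz. [folklore] -/
theorem lipschitzWith_mul_bounded {f g : α → ℝ} {Kf Kg : NNReal} {A B : ℝ} (hf : LipschitzWith Kf f)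
    (hg : LipschitzWith Kg g) (hA : ∀ x, |f x| ≤ A) (hB : ∀ x, |g x| ≤ B) :
    LipschitzWith (Real.toNNReal (A * Kg + B * Kf)) fun x => f x * g x := by
  refine LipschitzWith.of_dist_le_mul fun x y => ?_
  have h1 := hf.dist_le_mul x y
  have h2 := hg.dist_le_mul x y
  rw [Real.dist_eq] at h1 h2 ⊢
  have hA0 : 0 ≤ A := (abs_nonneg _).trans (hA x)
  have hB0 : 0 ≤ B := (abs_nonneg _).trans (hB x)
  have hK : ((Real.toNNReal (A * Kg + B * Kf) : NNReal) : ℝ) = A * Kg + B * Kf :=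
    Real.coe_toNNReal _ (by positivity)
  rw [hK]
  calc |f x * g x - f y * g y| = |f x * (g x - g y) + (f x - f y) * g y| := by ring_nf
    _ ≤ |f x| * |g x - g y| + |f x - f y| * |g y| := by
        refine (abs_add_le _ _).trans ?_
        rw [abs_mul, abs_mul]
    _ ≤ A * (Kg * dist x y) + Kf * dist x y * B := by
        gcongr
        · exact hA x
        · exact hB y
    _ = (A * Kg + B * Kf) * dist x y := by ring

/-- A constant multiple of a Lipschitz real function is Lipschitz. [folklore] -/
theorem lipschitzWith_const_mul' {f : α → ℝ} {K : NNReal} (hf : LipschitzWith K f) (c : ℝ) :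
    LipschitzWith (Real.toNNReal |c| * K) fun x => c * f x := by
  refine LipschitzWith.of_dist_le_mul fun x y => ?_
  have h1 := hf.dist_le_mul x y
  rw [Real.dist_eq] at h1 ⊢
  rw [← mul_sub, abs_mul, NNReal.coe_mul, Real.coe_toNNReal _ (abs_nonneg c), mul_assoc]
  exact mul_le_mul_of_nonneg_left h1 (abs_nonneg c)

/-- The inverse of a Lipschitz real function bounded below by a positive constant is Lipschitz. [folklore] -/
theorem lipschitzWith_inv_of_ge {f : α → ℝ} {K : NNReal} {c : ℝ} (hf : LipschitzWith K f) (hc : 0 < c)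
    (hge : ∀ x, c ≤ f x) : LipschitzWith (Real.toNNReal (K / c ^ 2)) fun x => (f x)⁻¹ := by
  refine LipschitzWith.of_dist_le_mul fun x y => ?_
  have h1 := hf.dist_le_mul x y
  rw [Real.dist_eq] at h1 ⊢
  have hx : 0 < f x := hc.trans_le (hge x)
  have hy : 0 < f y := hc.trans_le (hge y)
  rw [Real.coe_toNNReal _ (by positivity), inv_sub_inv hx.ne' hy.ne', abs_div, abs_mul,
    abs_of_pos hx, abs_of_pos hy, abs_sub_comm, div_le_iff₀ (mul_pos hx hy)]
  calc |f x - f y| ≤ K * dist x y := h1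
    _ = K / c ^ 2 * dist x y * (c * c) := by field_simp
    _ ≤ K / c ^ 2 * dist x y * (f x * f y) := by
        refine mul_le_mul_of_nonneg_left ?_ (by positivity)
        exact mul_le_mul (hge x) (hge y) hc.le hx.le

/-- Post-composition of a Lipschitz real function with a function Lipschitz on a set containing its range.
[folklore] -/
theorem lipschitzWith_comp_of_lipschitzOnWith {g : ℝ → ℝ} {Kg : NNReal} {s : Set ℝ} (hg : LipschitzOnWith Kg g s)
    {f : α → ℝ} {Kf : NNReal} (hf : LipschitzWith Kf f) (hs : ∀ x, f x ∈ s) :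
    LipschitzWith (Kg * Kf) fun x => g (f x) :=
  lipschitzOnWith_univ.1 (hg.comp hf.lipschitzOnWith fun x _ => hs x)

/-- Finite sums of Lipschitz real functions are Lipschitz. [folklore] -/
theorem lipschitzWith_finset_sum {ι : Type*} (s : Finset ι) {f : ι → α → ℝ} {K : ι → NNReal}
    (h : ∀ i ∈ s, LipschitzWith (K i) (f i)) : LipschitzWith (∑ i ∈ s, K i) fun x => ∑ i ∈ s, f i x := by
  classical
  induction s using Finset.induction_on with
  | empty => simp
  | insert a s ha ih =>
    simp only [Finset.sum_insert ha]
    exact (h a (Finset.mem_insert_self a s)).add (ih fun i hi => h i (Finset.mem_insert_of_mem hi))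

/-- A Lipschitz real function on a compact space is bounded. [folklore] -/
theorem exists_abs_le_of_lipschitzWith [CompactSpace α] [Nonempty α] {f : α → ℝ} {K : NNReal}
    (hf : LipschitzWith K f) : ∃ A, ∀ x, |f x| ≤ A := by
  obtain ⟨A, hA⟩ := isCompact_univ.exists_bound_of_continuousOn (hf.continuous.continuousOn (s := Set.univ))
  exact ⟨A, fun x => by simpa [Real.norm_eq_abs] using hA x (Set.mem_univ x)⟩

/-- The logarithm is `c⁻¹`-Lipschitz on `[c, ∞)` for `c > 0`. [folklore] -/
theorem lipschitzOnWith_log_Ici {c : ℝ} (hc : 0 < c) : LipschitzOnWith (Real.toNNReal c⁻¹) Real.log (Set.Ici c) := by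
  have key : ∀ a b : ℝ, c ≤ a → c ≤ b → Real.log a - Real.log b ≤ c⁻¹ * |a - b| := by
    intro a b ha hb
    have ha0 : 0 < a := hc.trans_le ha
    have hb0 : 0 < b := hc.trans_le hb
    rw [← Real.log_div ha0.ne' hb0.ne']
    have h1 := Real.log_le_sub_one_of_pos (div_pos ha0 hb0)
    have h2 : a / b - 1 = (a - b) / b := by field_simp
    rw [h2] at h1
    refine h1.trans ?_
    rw [div_le_iff₀ hb0]
    calc a - b ≤ |a - b| := le_abs_self _
      _ = c⁻¹ * |a - b| * c := by field_simp
      _ ≤ c⁻¹ * |a - b| * b := mul_le_mul_of_nonneg_left hb (by positivity)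
  refine LipschitzOnWith.of_dist_le_mul fun a ha b hb => ?_
  rw [Real.dist_eq, Real.dist_eq, Real.coe_toNNReal _ (by positivity), abs_sub_le_iff]
  constructor
  · linarith [key a b ha hb]
  · have := key b a hb ha
    rw [abs_sub_comm] at this
    linarith

end Lipschitz

/-! ## The equation-of-state band -/

/-- The band width is positive. [folklore] -/
theorem eos_pos {η₀ : ℝ} {F : ℝ → ℝ} (h : EosBand η₀ F) : 0 < η₀ := h.1

/-- Inside the band the excess free energy agrees with its real-analytic version near every point. [folklore] -/
theorem eos_eventuallyEq {η₀ : ℝ} {F : ℝ → ℝ} (h : EosBand η₀ F) {η : ℝ} (hη : η ∈ Set.Ioo 0 η₀) :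
    hsExcessFreeEnergy =ᶠ[𝓝 η] F := by
  filter_upwards [Ioo_mem_nhds hη.1 hη.2] with η' hη'
  exact h.2.2 ⟨hη'.1.le, hη'.2⟩

/-- Inside the band the excess free energy is smooth. [folklore] -/
theorem eos_contDiffAt {η₀ : ℝ} {F : ℝ → ℝ} (h : EosBand η₀ F) {η : ℝ} (hη : η ∈ Set.Ioo 0 η₀)
    {n : WithTop ℕ∞} : ContDiffAt ℝ n hsExcessFreeEnergy η := by
  have hF : AnalyticAt ℝ F η := h.2.1 η ⟨by linarith [hη.1, h.1], hη.2⟩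
  exact hF.contDiffAt.congr_of_eventuallyEq (eos_eventuallyEq h hη)

/-- Inside the band the excess free energy is smooth (set version). [folklore] -/
theorem eos_contDiffOn {η₀ : ℝ} {F : ℝ → ℝ} (h : EosBand η₀ F) {n : WithTop ℕ∞} :
    ContDiffOn ℝ n hsExcessFreeEnergy (Set.Ioo 0 η₀) := fun _ hη => (eos_contDiffAt h hη).contDiffWithinAt

/-- Inside the band the excess free energy is differentiable, with derivative `deriv hsExcessFreeEnergy`.
[folklore] -/
theorem eos_hasDerivAt {η₀ : ℝ} {F : ℝ → ℝ} (h : EosBand η₀ F) {η : ℝ} (hη : η ∈ Set.Ioo 0 η₀) :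
    HasDerivAt hsExcessFreeEnergy (deriv hsExcessFreeEnergy η) η :=
  ((eos_contDiffAt h hη (n := 1)).differentiableAt one_ne_zero).hasDerivAt

/-- On a compact sub-interval of the band the excess free energy is Lipschitz. [folklore] -/
theorem eos_exists_lipschitzOnWith {η₀ : ℝ} {F : ℝ → ℝ} (h : EosBand η₀ F) {a b : ℝ} (ha : 0 < a)
    (hb : b < η₀) : ∃ K, LipschitzOnWith K hsExcessFreeEnergy (Set.Icc a b) :=
  ((eos_contDiffOn h (n := 1)).mono (Set.Icc_subset_Ioo ha hb)).exists_lipschitzOnWith one_ne_zero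
    (convex_Icc a b) isCompact_Icc

/-- On a compact sub-interval of the band the derivative of the excess free energy is Lipschitz. [folklore] -/
theorem eos_exists_lipschitzOnWith_deriv {η₀ : ℝ} {F : ℝ → ℝ} (h : EosBand η₀ F) {a b : ℝ} (ha : 0 < a)
    (hb : b < η₀) : ∃ K, LipschitzOnWith K (deriv hsExcessFreeEnergy) (Set.Icc a b) := by
  have h2 : ContDiffOn ℝ 1 (deriv hsExcessFreeEnergy) (Set.Ioo 0 η₀) :=
    (eos_contDiffOn h (n := 2)).deriv_of_isOpen isOpen_Ioo (by norm_num)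
  exact (h2.mono (Set.Icc_subset_Ioo ha hb)).exists_lipschitzOnWith one_ne_zero (convex_Icc a b) isCompact_Icc

/-! ## The smooth branch of the guarded entropy and its chain rule -/

/-- The smooth branch `-(ρ(3/2 log θ - log ρ - f_ex(ρσ³)))` of the guarded entropy `Hs`. [folklore] -/
def Hsm (σ ρ θ : ℝ) : ℝ :=
  -(ρ * (3 / 2 * Real.log θ - Real.log ρ - hsExcessFreeEnergy (ρ * σ ^ 3)))

/-- Off the guard the entropy is its smooth branch. [folklore] -/
theorem Hs_eq_Hsm {σ ρ θ : ℝ} (hρ : 0 < ρ) (hθ : 0 < θ) : Hs σ ρ θ = Hsm σ ρ θ :=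
  if_pos ⟨hρ, hθ⟩

/-- **Chain rule for the entropy density along a curve** `t ↦ (ρ(t), θ(t))` in the regular range:
`d/dt H = H ρ'/ρ - (3/2)ρθ'/θ + ρ' + f_ex'(ρσ³) σ³ ρ ρ'` (the logarithms only enter through `H` itself).
[folklore] -/
theorem hasDerivAt_Hsm {η₀ : ℝ} {F : ℝ → ℝ} (hE : EosBand η₀ F) {σ : ℝ} {ρf θf : ℝ → ℝ} {ρ' θ' t : ℝ}
    (hρ : HasDerivAt ρf ρ' t) (hθ : HasDerivAt θf θ' t) (hρ0 : 0 < ρf t) (hθ0 : 0 < θf t) (hσ : 0 < σ)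
    (hband : ρf t * σ ^ 3 < η₀) :
    HasDerivAt (fun s => Hsm σ (ρf s) (θf s))
      (Hsm σ (ρf t) (θf t) * ρ' / ρf t - 3 / 2 * ρf t * θ' / θf t + ρ'
        + deriv hsExcessFreeEnergy (ρf t * σ ^ 3) * σ ^ 3 * ρf t * ρ') t := by
  have hη : ρf t * σ ^ 3 ∈ Set.Ioo 0 η₀ := ⟨by positivity, hband⟩
  have h1 : HasDerivAt (fun s => Real.log (θf s)) (θ' / θf t) t := hθ.log hθ0.ne'
  have h2 : HasDerivAt (fun s => Real.log (ρf s)) (ρ' / ρf t) t := hρ.log hρ0.ne'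
  have h3 := (eos_hasDerivAt hE hη).comp t (hρ.mul_const (σ ^ 3))
  have h4 := (hρ.mul (((h1.const_mul (3 / 2)).sub h2).sub h3)).neg
  refine h4.congr_deriv ?_
  simp only [Pi.sub_apply, Function.comp_apply]
  unfold Hsm
  field_simp
  ring

/-- The guarded entropy along a curve in the regular range has the same derivative as its smooth branch.
[folklore] -/
theorem hasDerivAt_Hs {η₀ : ℝ} {F : ℝ → ℝ} (hE : EosBand η₀ F) {σ : ℝ} {ρf θf : ℝ → ℝ} {ρ' θ' t : ℝ}
    (hρ : HasDerivAt ρf ρ' t) (hθ : HasDerivAt θf θ' t) (hρ0 : 0 < ρf t) (hθ0 : 0 < θf t) (hσ : 0 < σ)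
    (hband : ρf t * σ ^ 3 < η₀) :
    HasDerivAt (fun s => Hs σ (ρf s) (θf s))
      (Hs σ (ρf t) (θf t) * ρ' / ρf t - 3 / 2 * ρf t * θ' / θf t + ρ'
        + deriv hsExcessFreeEnergy (ρf t * σ ^ 3) * σ ^ 3 * ρf t * ρ') t := by
  rw [Hs_eq_Hsm hρ0 hθ0]
  refine (hasDerivAt_Hsm hE hρ hθ hρ0 hθ0 hσ hband).congr_of_eventuallyEq ?_
  filter_upwards [hρ.continuousAt.eventually (lt_mem_nhds hρ0), hθ.continuousAt.eventually (lt_mem_nhds hθ0)]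
    with s h1 h2
  exact Hs_eq_Hsm h1 h2

/-! ## Convexity of the entropy in the conserved variables at fixed density -/

/-- **Supporting-hyperplane inequality.** At fixed `ρ > 0`, for two states `(m₁, e₁)`, `(m₂, e₂)` with positive
temperatures `θᵢ = (2/3)(eᵢ/ρ - |mᵢ|²/(2ρ²))`,
`H(ρ,θ₁) - H(ρ,θ₂) ≥ ∑ₖ (u₂ₖ/θ₂)(m₁ₖ - m₂ₖ) - (e₁ - e₂)/θ₂`, `u₂ = m₂/ρ`: the entropy density is convex in
`(m, e)` (`-log` is convex and decreasing, `θ` is concave in `(m, e)`), and `∂H/∂m = u/θ`, `∂H/∂e = -1/θ`.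
[folklore] -/
theorem Hsm_sub_Hsm_ge {σ ρ e₁ e₂ θ₁ θ₂ : ℝ} {m₁ m₂ : Fin 3 → ℝ} (hρ : 0 < ρ)
    (hθ₁ : θ₁ = 2 / 3 * (e₁ / ρ - (∑ k, m₁ k ^ 2) / (2 * ρ ^ 2)))
    (hθ₂ : θ₂ = 2 / 3 * (e₂ / ρ - (∑ k, m₂ k ^ 2) / (2 * ρ ^ 2))) (h₁ : 0 < θ₁) (h₂ : 0 < θ₂) :
    (∑ k, ρ⁻¹ * m₂ k / θ₂ * (m₁ k - m₂ k)) - (e₁ - e₂) / θ₂ ≤ Hsm σ ρ θ₁ - Hsm σ ρ θ₂ := by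
  have hlog : Real.log θ₁ - Real.log θ₂ ≤ (θ₁ - θ₂) / θ₂ := by
    rw [← Real.log_div h₁.ne' h₂.ne']
    have h := Real.log_le_sub_one_of_pos (div_pos h₁ h₂)
    have e : θ₁ / θ₂ - 1 = (θ₁ - θ₂) / θ₂ := by field_simp
    rwa [e] at h
  have hsq : 2 * ∑ k, m₂ k * (m₁ k - m₂ k) ≤ (∑ k, m₁ k ^ 2) - ∑ k, m₂ k ^ 2 := by
    simp only [Fin.sum_univ_three]
    nlinarith [sq_nonneg (m₁ 0 - m₂ 0), sq_nonneg (m₁ 1 - m₂ 1), sq_nonneg (m₁ 2 - m₂ 2)]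
  have hθdiff : θ₁ - θ₂ ≤ 2 / 3 * ((e₁ - e₂) / ρ - (∑ k, m₂ k * (m₁ k - m₂ k)) / ρ ^ 2) := by
    have hρ2 : 0 < ρ ^ 2 := by positivity
    have key : (∑ k, m₂ k * (m₁ k - m₂ k)) / ρ ^ 2 ≤ ((∑ k, m₁ k ^ 2) - ∑ k, m₂ k ^ 2) / (2 * ρ ^ 2) := by
      rw [div_le_div_iff₀ hρ2 (by positivity)]
      nlinarith
    have e : θ₁ - θ₂ = 2 / 3 * ((e₁ - e₂) / ρ - ((∑ k, m₁ k ^ 2) - ∑ k, m₂ k ^ 2) / (2 * ρ ^ 2)) := by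
      rw [hθ₁, hθ₂]; ring
    rw [e]
    linarith
  have hH : Hsm σ ρ θ₁ - Hsm σ ρ θ₂ = -(3 / 2 * ρ) * (Real.log θ₁ - Real.log θ₂) := by
    unfold Hsm; ring
  rw [hH]
  have hneg : -(3 / 2 * ρ) < 0 := by linarith
  calc (∑ k, ρ⁻¹ * m₂ k / θ₂ * (m₁ k - m₂ k)) - (e₁ - e₂) / θ₂
      = -(3 / 2 * ρ) * (2 / 3 * ((e₁ - e₂) / ρ - (∑ k, m₂ k * (m₁ k - m₂ k)) / ρ ^ 2) / θ₂) := by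
        simp only [Fin.sum_univ_three]
        field_simp
        ring
    _ ≤ -(3 / 2 * ρ) * ((θ₁ - θ₂) / θ₂) := by
        refine mul_le_mul_of_nonpos_left ?_ hneg.le
        exact div_le_div_of_nonneg_right hθdiff h₂.le
    _ ≤ -(3 / 2 * ρ) * (Real.log θ₁ - Real.log θ₂) := mul_le_mul_of_nonpos_left hlog hneg.le

/-! ## Derivatives of the coarse temperature, velocity and kinetic heat current along a curve of moments -/

/-- The coarse temperature `θ = (2/3)(e/ρ - |m|²/(2ρ²))` along a differentiable curve of moments. [folklore] -/
theorem hasDerivAt_theta_curve {ρf ef : ℝ → ℝ} {mf : Fin 3 → ℝ → ℝ} {ρ' e' : ℝ} {m' : Fin 3 → ℝ} {t : ℝ}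
    (hρ : HasDerivAt ρf ρ' t) (hm : ∀ k, HasDerivAt (mf k) (m' k) t) (he : HasDerivAt ef e' t)
    (hρ0 : ρf t ≠ 0) :
    HasDerivAt (fun s => 2 / 3 * (ef s / ρf s - (∑ k, mf k s ^ 2) / (2 * ρf s ^ 2)))
      (2 / 3 * (e' / ρf t - ef t * ρ' / ρf t ^ 2 - (∑ k, mf k t * m' k) / ρf t ^ 2
        + (∑ k, mf k t ^ 2) * ρ' / ρf t ^ 3)) t := by
  have h1 : HasDerivAt (fun s => ef s / ρf s) ((e' * ρf t - ef t * ρ') / ρf t ^ 2) t := he.div hρ hρ0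
  have h2 : HasDerivAt (fun s => ∑ k, mf k s ^ 2) (∑ k, (2 : ℕ) * mf k t ^ (2 - 1) * m' k) t :=
    HasDerivAt.fun_sum fun k _ => (hm k).pow 2
  have h3 : HasDerivAt (fun s => 2 * ρf s ^ 2) (2 * ((2 : ℕ) * ρf t ^ (2 - 1) * ρ')) t := (hρ.pow 2).const_mul 2
  have h4 := ((h1.sub (h2.div h3 (by positivity))).const_mul (2 / 3))
  refine h4.congr_deriv ?_
  simp only [Nat.cast_ofNat, Nat.add_one_sub_one, pow_one, Fin.sum_univ_three]
  field_simp
  ring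

/-- The coarse velocity `u_k = m_k/ρ` along a differentiable curve of moments. [folklore] -/
theorem hasDerivAt_u_curve {ρf mf : ℝ → ℝ} {ρ' m' t : ℝ} (hρ : HasDerivAt ρf ρ' t) (hm : HasDerivAt mf m' t)
    (hρ0 : ρf t ≠ 0) :
    HasDerivAt (fun s => (ρf s)⁻¹ * mf s) (m' / ρf t - mf t * ρ' / ρf t ^ 2) t := by
  refine ((hρ.inv hρ0).mul hm).congr_deriv ?_
  simp only [Pi.inv_apply]
  field_simp
  ring

/-- The kinetic heat current `q_k = Q_k - u_k e - ∑ₗ uₗ M_{lk} + u_k (u·m) + (|u|²/2)(m_k - ρ u_k)` along a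
differentiable curve of moments and velocities (raw product rule). [folklore] -/
theorem hasDerivAt_q_curve {ρf ef Qf : ℝ → ℝ} {mf uf Mf : Fin 3 → ℝ → ℝ} {ρ' e' Q' : ℝ}
    {m' u' M' : Fin 3 → ℝ} {t : ℝ} (k : Fin 3)
    (hρ : HasDerivAt ρf ρ' t) (hm : ∀ l, HasDerivAt (mf l) (m' l) t) (he : HasDerivAt ef e' t)
    (hu : ∀ l, HasDerivAt (uf l) (u' l) t) (hM : ∀ l, HasDerivAt (Mf l) (M' l) t)
    (hQ : HasDerivAt Qf Q' t) :
    HasDerivAt (fun s => Qf s - uf k s * ef s - ∑ l, uf l s * Mf l s + uf k s * (∑ l, uf l s * mf l s)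
        + (∑ l, uf l s ^ 2) / 2 * (mf k s - ρf s * uf k s))
      (Q' - (u' k * ef t + uf k t * e') - ∑ l, (u' l * Mf l t + uf l t * M' l)
        + (u' k * (∑ l, uf l t * mf l t) + uf k t * ∑ l, (u' l * mf l t + uf l t * m' l))
        + ((∑ l, 2 * uf l t * u' l) / 2 * (mf k t - ρf t * uf k t)
          + (∑ l, uf l t ^ 2) / 2 * (m' k - (ρ' * uf k t + ρf t * u' k)))) t := by
  have h1 : HasDerivAt (fun s => ∑ l, uf l s * Mf l s) (∑ l, (u' l * Mf l t + uf l t * M' l)) t :=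
    HasDerivAt.fun_sum fun l _ => (hu l).mul (hM l)
  have h2 : HasDerivAt (fun s => ∑ l, uf l s * mf l s) (∑ l, (u' l * mf l t + uf l t * m' l)) t :=
    HasDerivAt.fun_sum fun l _ => (hu l).mul (hm l)
  have h3 : HasDerivAt (fun s => ∑ l, uf l s ^ 2) (∑ l, (2 : ℕ) * uf l t ^ (2 - 1) * u' l) t :=
    HasDerivAt.fun_sum fun l _ => (hu l).pow 2
  have h4 := (((hQ.sub ((hu k).mul he)).sub h1).add ((hu k).mul h2)).add
    ((h3.div_const 2).mul ((hm k).sub (hρ.mul (hu k))))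
  refine h4.congr_deriv ?_
  simp only [Nat.cast_ofNat, Nat.add_one_sub_one, pow_one, Pi.sub_apply, Pi.mul_apply]

end L

/-- **Registered sub-goal `ledgerL_calculus`** of stub `stub_ledger` (line `exact-entropy-ledger-three-passivities`):
Convexity of the entropy density in the conserved variables at fixed density (supporting hyperplane). [folklore] -/
theorem ledgerL_calculus :
  ∀ {σ ρ e₁ e₂ θ₁ θ₂ : ℝ} {m₁ m₂ : Fin 3 → ℝ}, 0 < ρ → θ₁ = 2 / 3 * (e₁ / ρ - (∑ k, m₁ k ^ 2) / (2 * ρ ^ 2)) → θ₂ = 2 / 3 * (e₂ / ρ - (∑ k, m₂ k ^ 2) / (2 * ρ ^ 2)) → 0 < θ₁ → 0 < θ₂ → (∑ k, ρ⁻¹ * m₂ k / θ₂ * (m₁ k - m₂ k)) - (e₁ - e₂) / θ₂ ≤ Hs σ ρ θ₁ - Hs σ ρ θ₂ :=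
  fun hρ h1 h2 hθ1 hθ2 => by rw [L.Hs_eq_Hsm hρ hθ1, L.Hs_eq_Hsm hρ hθ2]; exact L.Hsm_sub_Hsm_ge hρ h1 h2 hθ1 hθ2

end Summit.AtomisticToContinuum.HydrodynamicLimit.Theorems.LocalSecondLawLedger

end
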